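import Literature.Probability.RandomPlanarGeometry.HexSAWSurfaceWallRenewalSecondGap
import HarnessLib

/-!
# Hexagonal-lattice SAWs at a surface: slack four — geometry of a four-down block (shields, shared rows, resurfacing)

Wall-renewal blocks of the brick-wall (hexagonal) half-plane walk (`ipwb m`: irreducible positive wall bridges of
length `m`) with FOUR down steps that do not return to the wall inside the block consist of an initial wall run
`0 … p`, seven monotone body runs between the eight vertical steps at times `p < t₂ < … < t₈`, and a final run back
along the wall (`…SlackFourFourDownRuns`). This module is the geometric half of the step from that run decomposition
to the constraint systems `Dddduuuu4Hyp`, … of `…SlackFourFourDownHyp` — the facts that do not depend on the order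
of the vertical steps, stated once over run data with column formulas only:

* `four_down_shield_low` / `four_down_shield_high` — IRR: irreducibility forbids the wall-renewal times `2` and
  `m − 2`, so a block whose initial run carries a visit has a vertical step at a column `≤ 2`, and one whose final
  run carries two visits has a vertical step at a column `≥ X − 1` (seven-run forms of the three-down shields of
  `…SlackFourThreeDownSystems`);

* `row_runs_apart` — ROWS: two monotone runs that never share a site of a common row occupy separated column
  intervals, in one of the two orders (stated on the four end columns);

* `resurface_right_of_initial_run` — WALL: the final run starts at a column `≥ p + 1`.

The order-dependent half (which runs share a row, the parities, the table hypotheses one by one) is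
`…SlackFourFourDownSystems<order>`.

STATUS: lane tool of the a-idea-1 bridge/renewal lineage, car 98-0 «four-down block geometry» — step (iv a) of the
classification of the four-down stratum of the slack-four row (FINDING-HEX-WALL-SLACK-FOUR-LAW). OURS (routine
tools; the three-down versions are private lemmas of `…SlackFourThreeDownSystems`, re-proved here publicly with
seven runs so that the four order modules share them). Sources: the renewal / irreducible-bridge structure [MS]
Madras–Slade §4.2 (Definition 4.2.1, p. 90), the brick-wall frame [EJ] Enting–Jensen §7.4.2, Fig. 7.10.
-/

namespace Literature.Probability.RandomPlanarGeometry.SAW.HexBW.Wall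

open Finset Filter Function
open Literature.Probability.LatticeModels Literature.Probability.Percolation SimpleGraph

variable {ω : ℕ → Site 2}

/-- Two coordinates determine a site of `ℤ²` (plumbing). [folklore] -/
private theorem site_ext_d4g {p q : Site 2} (h0 : p 0 = q 0) (h1 : p 1 = q 1) : p = q := by
  funext k
  fin_cases k
  · exact h0
  · exact h1

/-- **Shield below the visit `(2, 0)`** of a four-down block (wall run `0 … p`, seven monotone body runs of
velocities `eⱼ = ±1` between the vertical steps at times `p < t₂ < … < t₈`, final run back along the wall from a
column `≥ p + 1`): if the initial wall run carries a visit (`p ≥ 3`), some vertical-step column is `≤ 2` — else `2`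
would be a wall-renewal time. Seven-run form of the three-down `ddduuu4_shield_low` (`…SlackFourThreeDownSystems`),
same proof. OURS (routine tool). [cite: MadrasSlade1993, §4.2, Definition 4.2.1 (p. 90)]
[cite: EntingJensen2009, §7.4.2, Fig. 7.10] -/
theorem four_down_shield_low {m p t₂ t₃ t₄ t₅ t₆ t₇ t₈ : ℕ} {e₁ e₂ e₃ e₄ e₅ e₆ e₇ : ℤ}
    (hbr : ∀ i, 1 ≤ i → i ≤ m → ω 0 0 < ω i 0 ∧ ω i 0 ≤ ω m 0) (hirr : ∀ t, 1 ≤ t → t < m → ¬ IsWRen m ω t)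
    (hR0 : ∀ i, i ≤ p → ω i 0 = i ∧ ω i 1 = 0) (he₁ : e₁ = 1 ∨ e₁ = -1) (he₂ : e₂ = 1 ∨ e₂ = -1)
    (he₃ : e₃ = 1 ∨ e₃ = -1) (he₄ : e₄ = 1 ∨ e₄ = -1) (he₅ : e₅ = 1 ∨ e₅ = -1) (he₆ : e₆ = 1 ∨ e₆ = -1)
    (he₇ : e₇ = 1 ∨ e₇ = -1) (hrun1 : ∀ i, p + 1 ≤ i → i ≤ t₂ → ω i 0 = p + e₁ * ((i - (p + 1) : ℕ) : ℤ))
    (hrun2 : ∀ i, t₂ + 1 ≤ i → i ≤ t₃ → ω i 0 = ω t₂ 0 + e₂ * ((i - (t₂ + 1) : ℕ) : ℤ))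
    (hrun3 : ∀ i, t₃ + 1 ≤ i → i ≤ t₄ → ω i 0 = ω t₃ 0 + e₃ * ((i - (t₃ + 1) : ℕ) : ℤ))
    (hrun4 : ∀ i, t₄ + 1 ≤ i → i ≤ t₅ → ω i 0 = ω t₄ 0 + e₄ * ((i - (t₄ + 1) : ℕ) : ℤ))
    (hrun5 : ∀ i, t₅ + 1 ≤ i → i ≤ t₆ → ω i 0 = ω t₅ 0 + e₅ * ((i - (t₅ + 1) : ℕ) : ℤ))
    (hrun6 : ∀ i, t₆ + 1 ≤ i → i ≤ t₇ → ω i 0 = ω t₆ 0 + e₆ * ((i - (t₆ + 1) : ℕ) : ℤ))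
    (hrun7 : ∀ i, t₇ + 1 ≤ i → i ≤ t₈ → ω i 0 = ω t₇ 0 + e₇ * ((i - (t₇ + 1) : ℕ) : ℤ))
    (hR8 : ∀ j, t₈ + 1 ≤ j → j ≤ m → ω j 0 = ω t₈ 0 + ((j - (t₈ + 1) : ℕ) : ℤ) ∧ ω j 1 = 0) (hp3 : 3 ≤ p)
    (hlt1 : p < t₂) (hlt2 : t₂ < t₃) (hlt3 : t₃ < t₄) (hlt4 : t₄ < t₅) (hlt5 : t₅ < t₆) (hlt6 : t₆ < t₇)
    (hlt7 : t₇ < t₈) (h8 : t₈ < m) (hg2 : (p : ℤ) + 1 ≤ ω t₈ 0) :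
    ω t₂ 0 ≤ 2 ∨ ω t₃ 0 ≤ 2 ∨ ω t₄ 0 ≤ 2 ∨ ω t₅ 0 ≤ 2 ∨ ω t₆ 0 ≤ 2 ∨ ω t₇ 0 ≤ 2 := by
  by_contra hcon
  simp only [not_or, not_le] at hcon
  obtain ⟨hc2, hc3, hc4, hc5, hc6, hc7⟩ := hcon
  have hb1 := hrun1 t₂ (by omega) le_rfl
  have hb2 := hrun2 t₃ (by omega) le_rfl
  have hb3 := hrun3 t₄ (by omega) le_rfl
  have hb4 := hrun4 t₅ (by omega) le_rfl
  have hb5 := hrun5 t₆ (by omega) le_rfl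
  have hb6 := hrun6 t₇ (by omega) le_rfl
  have hb7 := hrun7 t₈ (by omega) le_rfl
  refine hirr 2 (by omega) (by omega) (isWRen_of_profile hbr (by omega) (by omega) (hR0 2 (by omega)).2 ?_ ?_)
  · intro i hi1 hi2; rw [(hR0 i (by omega)).1, (hR0 2 (by omega)).1]; omega
  · intro j hj1 hj2
    rw [(hR0 2 (by omega)).1]
    rcases Nat.lt_or_ge j (p + 1) with hj | hj
    · rw [(hR0 j (by omega)).1]; omega
    rcases Nat.lt_or_ge j (t₂ + 1) with hja | hja
    · have := hrun1 j hj (by omega); rcases he₁ with rfl | rfl <;> omega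
    rcases Nat.lt_or_ge j (t₃ + 1) with hjb | hjb
    · have := hrun2 j hja (by omega); rcases he₂ with rfl | rfl <;> omega
    rcases Nat.lt_or_ge j (t₄ + 1) with hjc | hjc
    · have := hrun3 j hjb (by omega); rcases he₃ with rfl | rfl <;> omega
    rcases Nat.lt_or_ge j (t₅ + 1) with hjd | hjd
    · have := hrun4 j hjc (by omega); rcases he₄ with rfl | rfl <;> omega
    rcases Nat.lt_or_ge j (t₆ + 1) with hje | hje
    · have := hrun5 j hjd (by omega); rcases he₅ with rfl | rfl <;> omega
    rcases Nat.lt_or_ge j (t₇ + 1) with hjf | hjf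
    · have := hrun6 j hje (by omega); rcases he₆ with rfl | rfl <;> omega
    rcases Nat.lt_or_ge j (t₈ + 1) with hjg | hjg
    · have := hrun7 j hjf (by omega); rcases he₇ with rfl | rfl <;> omega
    · have := (hR8 j hjg hj2).1; omega

/-- **Shield above the visit `(X − 2, 0)`** of a four-down block (same data): if the final wall run carries two
visits (`t₈ + 4 ≤ m`), some vertical-step column is `≥ X − 1` (`X = ω m 0`) — else `m − 2` would be a wall-renewal
time. Seven-run form of `ddduuu4_shield_high` (`…SlackFourThreeDownSystems`). OURS (routine tool).
[cite: MadrasSlade1993, §4.2, Definition 4.2.1 (p. 90)] [cite: EntingJensen2009, §7.4.2, Fig. 7.10] -/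
theorem four_down_shield_high {m p t₂ t₃ t₄ t₅ t₆ t₇ t₈ : ℕ} {e₁ e₂ e₃ e₄ e₅ e₆ e₇ : ℤ}
    (hbr : ∀ i, 1 ≤ i → i ≤ m → ω 0 0 < ω i 0 ∧ ω i 0 ≤ ω m 0) (hirr : ∀ t, 1 ≤ t → t < m → ¬ IsWRen m ω t)
    (hR0 : ∀ i, i ≤ p → ω i 0 = i ∧ ω i 1 = 0) (he₁ : e₁ = 1 ∨ e₁ = -1) (he₂ : e₂ = 1 ∨ e₂ = -1)
    (he₃ : e₃ = 1 ∨ e₃ = -1) (he₄ : e₄ = 1 ∨ e₄ = -1) (he₅ : e₅ = 1 ∨ e₅ = -1) (he₆ : e₆ = 1 ∨ e₆ = -1)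
    (he₇ : e₇ = 1 ∨ e₇ = -1) (hrun1 : ∀ i, p + 1 ≤ i → i ≤ t₂ → ω i 0 = p + e₁ * ((i - (p + 1) : ℕ) : ℤ))
    (hrun2 : ∀ i, t₂ + 1 ≤ i → i ≤ t₃ → ω i 0 = ω t₂ 0 + e₂ * ((i - (t₂ + 1) : ℕ) : ℤ))
    (hrun3 : ∀ i, t₃ + 1 ≤ i → i ≤ t₄ → ω i 0 = ω t₃ 0 + e₃ * ((i - (t₃ + 1) : ℕ) : ℤ))
    (hrun4 : ∀ i, t₄ + 1 ≤ i → i ≤ t₅ → ω i 0 = ω t₄ 0 + e₄ * ((i - (t₄ + 1) : ℕ) : ℤ))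
    (hrun5 : ∀ i, t₅ + 1 ≤ i → i ≤ t₆ → ω i 0 = ω t₅ 0 + e₅ * ((i - (t₅ + 1) : ℕ) : ℤ))
    (hrun6 : ∀ i, t₆ + 1 ≤ i → i ≤ t₇ → ω i 0 = ω t₆ 0 + e₆ * ((i - (t₆ + 1) : ℕ) : ℤ))
    (hrun7 : ∀ i, t₇ + 1 ≤ i → i ≤ t₈ → ω i 0 = ω t₇ 0 + e₇ * ((i - (t₇ + 1) : ℕ) : ℤ))
    (hR8 : ∀ j, t₈ + 1 ≤ j → j ≤ m → ω j 0 = ω t₈ 0 + ((j - (t₈ + 1) : ℕ) : ℤ) ∧ ω j 1 = 0) (hs4 : t₈ + 4 ≤ m)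
    (hm2 : m % 2 = 0) (hlt1 : p < t₂) (hlt2 : t₂ < t₃) (hlt3 : t₃ < t₄) (hlt4 : t₄ < t₅) (hlt5 : t₅ < t₆)
    (hlt6 : t₆ < t₇) (hlt7 : t₇ < t₈) (hg2 : (p : ℤ) + 1 ≤ ω t₈ 0) :
    ω m 0 ≤ ω t₂ 0 + 1 ∨ ω m 0 ≤ ω t₃ 0 + 1 ∨ ω m 0 ≤ ω t₄ 0 + 1 ∨ ω m 0 ≤ ω t₅ 0 + 1 ∨ ω m 0 ≤ ω t₆ 0 + 1 ∨
      ω m 0 ≤ ω t₇ 0 + 1 := by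
  by_contra hcon
  simp only [not_or, not_le] at hcon
  obtain ⟨hc2, hc3, hc4, hc5, hc6, hc7⟩ := hcon
  have hb1 := hrun1 t₂ (by omega) le_rfl
  have hb2 := hrun2 t₃ (by omega) le_rfl
  have hb3 := hrun3 t₄ (by omega) le_rfl
  have hb4 := hrun4 t₅ (by omega) le_rfl
  have hb5 := hrun5 t₆ (by omega) le_rfl
  have hb6 := hrun6 t₇ (by omega) le_rfl
  have hb7 := hrun7 t₈ (by omega) le_rfl
  have hM2 := hR8 (m - 2) (by omega) (by omega)
  have hN := (hR8 m (by omega) le_rfl).1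
  refine hirr (m - 2) (by omega) (by omega) (isWRen_of_profile hbr (by omega) (by omega) hM2.2 ?_ ?_)
  · intro i hi1 hi2
    rw [hM2.1]
    rcases Nat.lt_or_ge i (p + 1) with hj | hj
    · rw [(hR0 i (by omega)).1]; omega
    rcases Nat.lt_or_ge i (t₂ + 1) with hja | hja
    · have := hrun1 i hj (by omega); rcases he₁ with rfl | rfl <;> omega
    rcases Nat.lt_or_ge i (t₃ + 1) with hjb | hjb
    · have := hrun2 i hja (by omega); rcases he₂ with rfl | rfl <;> omega
    rcases Nat.lt_or_ge i (t₄ + 1) with hjc | hjc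
    · have := hrun3 i hjb (by omega); rcases he₃ with rfl | rfl <;> omega
    rcases Nat.lt_or_ge i (t₅ + 1) with hjd | hjd
    · have := hrun4 i hjc (by omega); rcases he₄ with rfl | rfl <;> omega
    rcases Nat.lt_or_ge i (t₆ + 1) with hje | hje
    · have := hrun5 i hjd (by omega); rcases he₅ with rfl | rfl <;> omega
    rcases Nat.lt_or_ge i (t₇ + 1) with hjf | hjf
    · have := hrun6 i hje (by omega); rcases he₆ with rfl | rfl <;> omega
    rcases Nat.lt_or_ge i (t₈ + 1) with hjg | hjg
    · have := hrun7 i hjf (by omega); rcases he₇ with rfl | rfl <;> omega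
    · have := (hR8 i hjg (by omega)).1; omega
  · intro j hj1 hj2
    rw [hM2.1, (hR8 j (by omega) hj2).1]; omega

/-- **Two runs on one row are separated.** If run A (times `tA + 1 … uA`, start column `a`, velocity `eA = ±1`) and
run B (times `tB + 1 … uB`, start column `c`, velocity `eB`) never share a column, then A's columns lie strictly
left of B's, or strictly right — stated on the four end columns. Public copy of the three-down `ddduuu4_runs_apart`
(`…SlackFourThreeDownSystems`, private there), same proof. OURS (routine tool).
[cite: MadrasSlade1993, §4.2, Definition 4.2.1 (p. 90)] [cite: EntingJensen2009, §7.4.2, Fig. 7.10] -/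
theorem row_runs_apart {a c eA eB : ℤ} {tA uA tB uB : ℕ}
    (heA : eA = 1 ∨ eA = -1) (heB : eB = 1 ∨ eB = -1) (htA : tA + 1 ≤ uA) (htB : tB + 1 ≤ uB)
    (hA : ∀ i, tA + 1 ≤ i → i ≤ uA → ω i 0 = a + eA * ((i - (tA + 1) : ℕ) : ℤ))
    (hB : ∀ j, tB + 1 ≤ j → j ≤ uB → ω j 0 = c + eB * ((j - (tB + 1) : ℕ) : ℤ))
    (hne : ∀ i j, tA + 1 ≤ i → i ≤ uA → tB + 1 ≤ j → j ≤ uB → ω i 0 ≠ ω j 0) :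
    (a < c ∧ a < ω uB 0 ∧ ω uA 0 < c ∧ ω uA 0 < ω uB 0) ∨ (c < a ∧ ω uB 0 < a ∧ c < ω uA 0 ∧ ω uB 0 < ω uA 0) := by
  have hAe := hA uA htA le_rfl
  have hBe := hB uB htB le_rfl
  by_contra hcon
  have key : ∀ x : ℤ, (min a (ω uA 0) ≤ x ∧ x ≤ max a (ω uA 0)) → (min c (ω uB 0) ≤ x ∧ x ≤ max c (ω uB 0))
      → False := by
    intro x hxA hxB
    have hiA : ∃ i, tA + 1 ≤ i ∧ i ≤ uA ∧ ω i 0 = x := by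
      refine ⟨tA + 1 + (x - a).natAbs, by omega, ?_, ?_⟩
      · rcases heA with rfl | rfl <;> simp only [min_def, max_def] at hxA <;> split_ifs at hxA <;> omega
      · rw [hA _ (by omega) (by rcases heA with rfl | rfl <;> simp only [min_def,
          max_def] at hxA <;> split_ifs at hxA <;> omega)]
        rcases heA with rfl | rfl <;> simp only [min_def, max_def] at hxA <;> split_ifs at hxA <;> omega
    have hiB : ∃ j, tB + 1 ≤ j ∧ j ≤ uB ∧ ω j 0 = x := by
      refine ⟨tB + 1 + (x - c).natAbs, by omega, ?_, ?_⟩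
      · rcases heB with rfl | rfl <;> simp only [min_def, max_def] at hxB <;> split_ifs at hxB <;> omega
      · rw [hB _ (by omega) (by rcases heB with rfl | rfl <;> simp only [min_def,
          max_def] at hxB <;> split_ifs at hxB <;> omega)]
        rcases heB with rfl | rfl <;> simp only [min_def, max_def] at hxB <;> split_ifs at hxB <;> omega
    obtain ⟨i, hi1, hi2, hix⟩ := hiA
    obtain ⟨j, hj1, hj2, hjx⟩ := hiB
    exact hne i j hi1 hi2 hj1 hj2 (by rw [hix, hjx])
  rcases le_or_gt (min a (ω uA 0)) (min c (ω uB 0)) with h | h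
  · refine key (min c (ω uB 0)) ⟨h, ?_⟩ ⟨le_rfl, min_le_max⟩
    simp only [min_def, max_def] at hcon h ⊢; split_ifs at hcon h ⊢ <;> omega
  · refine key (min a (ω uA 0)) ⟨le_rfl, min_le_max⟩ ⟨h.le, ?_⟩
    simp only [min_def, max_def] at hcon h ⊢; split_ifs at hcon h ⊢ <;> omega

/-- **The resurfacing column lies right of the initial wall run**: if the walk runs along the wall for times `0 … p`
and returns to the wall at time `t + 1` (`p < t`) for its final rightward run, then `ω t 0 ≥ p + 1` (the wall site
reached at time `t + 1` is none of the sites `(i, 0)`, `i ≤ p`). Public copy of the three-down `ddduuu4_wall`, same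
proof. OURS (routine tool). [cite: MadrasSlade1993, §4.2, Definition 4.2.1 (p. 90)]
[cite: EntingJensen2009, §7.4.2, Fig. 7.10] -/
theorem resurface_right_of_initial_run {m p t : ℕ}
    (hinj : Set.InjOn ω {i | i ≤ m}) (hpos : ∀ i, 1 ≤ i → i ≤ m → 0 < ω i 0) (hpt : p < t) (htm : t < m)
    (hR0 : ∀ i, i ≤ p → ω i 0 = i ∧ ω i 1 = 0)
    (hR8 : ∀ j, t + 1 ≤ j → j ≤ m → ω j 0 = ω t 0 + ((j - (t + 1) : ℕ) : ℤ) ∧ ω j 1 = 0) :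
    (p : ℤ) + 1 ≤ ω t 0 := by
  by_contra hlt
  have hS := hR8 (t + 1) le_rfl (by omega)
  have hx0 : 0 ≤ ω t 0 := by have := hpos (t + 1) (by omega) (by omega); rw [hS.1] at this; omega
  obtain ⟨x, hx⟩ := Int.eq_ofNat_of_zero_le hx0
  have hxp : x ≤ p := by omega
  have hmem : ∀ i, i ≤ m → i ∈ {i | i ≤ m} := fun i hi => hi
  have := hinj (hmem (t + 1) (by omega)) (hmem x (by omega))
    (site_ext_d4g (by rw [hS.1, (hR0 x hxp).1, hx]; omega) (by rw [hS.2, (hR0 x hxp).2]))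
  omega

end Literature.Probability.RandomPlanarGeometry.SAW.HexBW.Wall
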